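import Literature.Probability.RandomPlanarGeometry.SAWPatternTheorem
import Literature.Probability.RandomPlanarGeometry.SelfAvoidingWalkProofs

/-!
# Line `kesten-product-renewal-dictionary` for the crux `SAWTotalPositivity.CriticalBubbleBound`
(stmt-CriticalPhenomena-7117): stub T3 `strip_gap_of` — the strip gap `μ(strip of width w) < μ(ℤ²)`

For every width `w`, the `n`-step self-avoiding walks on `ℤ²` from `0` whose first coordinates stay in a
window of width `w` ("`w`-narrow" walks) number at most `C ρⁿ` for some `ρ < μ = Zd.connectiveConstant 2`
(the floor of conjecture B1 of the line; stub T4 turns it into finiteness of the pinned critical length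
mass). Proved by induction on `w`, CONSUMING AS HYPOTHESES the two combinatorial stubs of the programme:
T1 (`detour_count`: walks with `m` vertical steps of a fixed parity in a column bounding all their columns,
times `C(m, j)`, inject into `(n+2j)`-step walks) and T2 (`badBlocks_le`: a `(w+1)`-narrow walk has at most
`2k + 4` blocks of length `M` that are not `w`-narrow, `k` = its number of vertical steps in the top column).
* Base `w = 0`: a `0`-narrow walk is vertical with a constant sign, so there are at most `3` of them.
* Step `w → w + 1` (block argument of Madras–Slade Lemma 7.2.5, cf. the tree's `Zd.lemma725`): split by the
  number `k` of vertical steps in the top column (`card_narrow_succ_le`). If `k > 2⌊n/q⌋`, T1 with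
  `j = (⌊n/q⌋+1)/s` detours, `s = ⌈8μ²⌉`, gives `≤ c_{n+2j}/sʲ ≤ 2K(θγ)ⁿ` walks, `θ = (1+η)μ`, `γ = 2^{-1/(qs)}`,
  `θγ < μ` (`case1_bound`). If `k ≤ 2⌊n/q⌋`, T2 gives `≤ 4⌊n/q⌋ + 4` bad blocks and the block decomposition
  `Zd.card_few_badBlocks_le` + Chernoff bound `Zd.sum_filter_card_le_chernoff` + induction hypothesis (good
  blocks are `w`-narrow: `#Good ≤ C₀ρ₀^M ≤ ρ₁^M/2`) give `≤ λ⁻⁴ C ρ₂ⁿ` walks, `ρ₁ < ρ₂ < μ` (`case2_bound`).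

Sources: N. Madras, G. Slade, *The Self-Avoiding Walk* (1993), §7.2, Lemma 7.2.5 (block argument); the
strip gap itself is folklore (Hammersley–Whittington 1985).
-/

noncomputable section

open Literature.Probability.LatticeModels
open Literature.Probability.RandomPlanarGeometry Literature.Probability.RandomPlanarGeometry.SAW
open scoped ENNReal NNReal BigOperators

namespace Summit.CriticalPhenomena.SAWScalingLimit.Theorems.CriticalBubbleBound.Kesten.Strip

/-! ## Base of the induction: vertical walks -/

/-- Inside one column of `ℤ²` a nearest-neighbour step is a vertical unit step. [folklore] -/
theorem adj_col {x y : Site 2} (h : (zdGraph 2).Adj x y) (h0 : x 0 = y 0) :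
    y 1 = x 1 + 1 ∨ y 1 = x 1 - 1 := by
  obtain ⟨i, hi | hi⟩ := (Zd.zdGraph_adj_iff_sub x y).1 h <;>
  · have e0 := congrFun hi 0
    have e1 := congrFun hi 1
    fin_cases i <;> simp at e0 e1 <;> omega

/-- A self-avoiding walk inside the column `0` is vertical with a constant sign (a sign change would
revisit a site): `ω i = (0, i • ω 1 1)`. [folklore] -/
theorem vertical_profile {n : ℕ} {ω : ℕ → Site 2} (hω : ω ∈ Zd.saws 2 n) (hcol : ∀ i ≤ n, ω i 0 = 0) :
    ∀ i ≤ n, ω i 1 = (i : ℤ) * ω 1 1 := by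
  obtain ⟨h0, -, hadj, hinj⟩ := Zd.mem_saws.1 hω
  have key : ∀ i, i + 1 + 1 ≤ n → ω (i + 1 + 1) 1 - ω (i + 1) 1 = ω (i + 1) 1 - ω i 1 := by
    intro i hi
    have a1 := adj_col (hadj i (by omega)) (by rw [hcol i (by omega), hcol (i + 1) (by omega)])
    have a2 := adj_col (hadj (i + 1) (by omega)) (by rw [hcol (i + 1) (by omega), hcol (i + 1 + 1) hi])
    by_contra hne
    have heq : ω (i + 1 + 1) = ω i := by
      funext j; fin_cases j
      · exact (hcol _ hi).trans (hcol _ (by omega)).symm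
      · show ω (i + 1 + 1) 1 = ω i 1; omega
    have := hinj (show i + 1 + 1 ∈ {i | i ≤ n} from hi) (show i ∈ {i | i ≤ n} from (by omega : i ≤ n)) heq
    omega
  have step : ∀ i, i + 1 ≤ n → ω (i + 1) 1 - ω i 1 = ω 1 1 := by
    intro i
    induction i with
    | zero => intro; simp [h0]
    | succ i ih => intro hi; rw [key i hi]; exact ih (by omega)
  intro i
  induction i with
  | zero => intro; simp [h0]
  | succ i ih => intro hi; have h1 := step i hi; have h2 := ih (by omega); push_cast; linarith

/-- At most `3` self-avoiding `n`-step walks stay in the column `0` (`ω ↦ ω 1 1 ∈ {-1,0,1}` injects). [folklore] -/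
theorem card_vertical_le {n : ℕ} {T : Finset (ℕ → Site 2)}
    (hT : ∀ ω ∈ T, ω ∈ Zd.saws 2 n ∧ ∀ i ≤ n, ω i 0 = 0) : T.card ≤ 3 := by
  classical
  refine (Finset.card_le_card_of_injOn (fun ω => ω 1 1) (t := {-1, 0, 1}) (fun ω hω => ?_)
    fun ω hω ω' hω' he => ?_).trans Finset.card_le_three
  · obtain ⟨hω, -⟩ := hT ω (Finset.mem_coe.1 hω)
    obtain ⟨h0, hend, hadj, -⟩ := Zd.mem_saws.1 hω
    have : |ω 1 1| ≤ 1 := by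
      rcases Nat.eq_zero_or_pos n with rfl | hn
      · rw [hend 1 (by omega), h0]; simp
      · simpa [h0] using Zd.abs_sub_le_one_of_adj (hadj 0 hn) 1
    rw [abs_le] at this
    simp only [Finset.coe_insert, Finset.coe_singleton, Set.mem_insert_iff, Set.mem_singleton_iff]
    omega
  · obtain ⟨hω, hc⟩ := hT ω (Finset.mem_coe.1 hω)
    obtain ⟨hω', hc'⟩ := hT ω' (Finset.mem_coe.1 hω')
    dsimp only at he
    have hv := vertical_profile hω hc
    have hv' := vertical_profile hω' hc'
    have hle : ∀ i ≤ n, ω i = ω' i := fun i hi => by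
      funext j; fin_cases j
      · exact (hc i hi).trans (hc' i hi).symm
      · show ω i 1 = ω' i 1; rw [hv i hi, hv' i hi, he]
    funext i
    rcases le_or_gt i n with hi | hi
    · exact hle i hi
    · rw [(Zd.mem_saws.1 hω).2.1 i hi.le, (Zd.mem_saws.1 hω').2.1 i hi.le, hle n le_rfl]

/-! ## The split of the `(w+1)`-narrow walks by the number of vertical steps in the maximal column -/

/-- **Case split.** With `m = a + 1`: a `(w+1)`-narrow walk either has `≥ m` vertical steps of one parity
in its maximal column `R ∈ {0, …, w+1}` (first sum), or, by T2, at most `4a + 4` blocks of length `M`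
that are not `w`-narrow (second term). [folklore] -/
theorem card_narrow_succ_le
    (H2 : ∀ (w n M : ℕ) (R : ℤ) (ω : ℕ → Site 2), 1 ≤ M → ω ∈ Zd.saws 2 n → (∀ i ≤ n, ω i 0 ≤ R) →
      (∀ i ≤ n, R ≤ ω i 0 + ((w : ℤ) + 1)) →
      (Zd.badBlocks (fun (M' : ℕ) (β : ℕ → Site 2) (_ : ℕ) => ¬ ∀ i ≤ M', ∀ i' ≤ M', β i 0 ≤ β i' 0 + (w : ℤ))
          M n ω).card ≤ 2 * ((Finset.range n).filter (fun t => ω t 0 = R ∧ ω (t + 1) 0 = R)).card + 4)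
    (w M n a : ℕ) (hM : 1 ≤ M) :
    (((Zd.saws 2 n).filter (fun ω => ∀ i ≤ n, ∀ i' ≤ n, ω i 0 ≤ ω i' 0 + ((w + 1 : ℕ) : ℤ))).card : ℝ) ≤
      (∑ r ∈ Finset.range (w + 2), ∑ p ∈ Finset.range 2,
        (((Zd.saws 2 n).filter (fun ω => (∀ i ≤ n, ω i 0 ≤ (r : ℤ)) ∧ a + 1 ≤
          ((Finset.range n).filter (fun t => t % 2 = p ∧ ω t 0 = (r : ℤ) ∧ ω (t + 1) 0 = (r : ℤ))).card)).card : ℝ)) +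
      (((Zd.saws 2 n).filter (fun ω => (Zd.badBlocks (fun (M' : ℕ) (β : ℕ → Site 2) (_ : ℕ) =>
          ¬ ∀ i ≤ M', ∀ i' ≤ M', β i 0 ≤ β i' 0 + (w : ℤ)) M n ω).card ≤ 4 * a + 4)).card : ℝ) := by
  classical
  obtain ⟨P, hP⟩ : ∃ P : (ℕ → Site 2) → Prop, P = fun ω => ∃ r ∈ Finset.range (w + 2), ∃ p ∈ Finset.range 2,
      (∀ i ≤ n, ω i 0 ≤ (r : ℤ)) ∧ a + 1 ≤
        ((Finset.range n).filter (fun t => t % 2 = p ∧ ω t 0 = (r : ℤ) ∧ ω (t + 1) 0 = (r : ℤ))).card := ⟨_, rfl⟩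
  set T := (Zd.saws 2 n).filter (fun ω => ∀ i ≤ n, ∀ i' ≤ n, ω i 0 ≤ ω i' 0 + ((w + 1 : ℕ) : ℤ)) with hT
  have hsplit := Finset.card_filter_add_card_filter_not (s := T) P
  -- Case 1: into the double union of the T1-sets
  have h1 : (T.filter P).card ≤ ∑ r ∈ Finset.range (w + 2), ∑ p ∈ Finset.range 2,
      ((Zd.saws 2 n).filter (fun ω => (∀ i ≤ n, ω i 0 ≤ (r : ℤ)) ∧ a + 1 ≤
        ((Finset.range n).filter (fun t => t % 2 = p ∧ ω t 0 = (r : ℤ) ∧ ω (t + 1) 0 = (r : ℤ))).card)).card := by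
    refine le_trans (Finset.card_le_card fun ω hω => ?_)
      (Finset.card_biUnion_le.trans (Finset.sum_le_sum fun r _ => Finset.card_biUnion_le))
    rw [Finset.mem_filter, hP] at hω
    obtain ⟨hωT, r, hr, p, hp, hrp⟩ := hω
    rw [Finset.mem_biUnion]
    exact ⟨r, hr, Finset.mem_biUnion.2 ⟨p, hp, Finset.mem_filter.2 ⟨(Finset.mem_filter.1 hωT).1, hrp⟩⟩⟩
  -- Case 2: few vertical steps in the maximal column `r`, hence (T2) few bad blocks
  have h2 : (T.filter fun ω => ¬ P ω).card ≤ ((Zd.saws 2 n).filter (fun ω => (Zd.badBlocks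
      (fun (M' : ℕ) (β : ℕ → Site 2) (_ : ℕ) => ¬ ∀ i ≤ M', ∀ i' ≤ M', β i 0 ≤ β i' 0 + (w : ℤ)) M n ω).card
        ≤ 4 * a + 4)).card := by
    refine Finset.card_le_card fun ω hω => ?_
    rw [Finset.mem_filter, hT, Finset.mem_filter] at hω
    obtain ⟨⟨hω, hnar⟩, hnP⟩ := hω
    refine Finset.mem_filter.2 ⟨hω, ?_⟩
    obtain ⟨i₀, hi₀, hmax⟩ := (Finset.range (n + 1)).exists_max_image (fun i => ω i 0) ⟨0, by simp⟩
    have hi₀n : i₀ ≤ n := Nat.lt_succ_iff.1 (Finset.mem_range.1 hi₀)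
    have hcol : ∀ i ≤ n, ω i 0 ≤ ω i₀ 0 := fun i hi => hmax i (Finset.mem_range.2 (Nat.lt_succ_of_le hi))
    have h00 : ω 0 0 = 0 := by rw [(Zd.mem_saws.1 hω).1]; rfl
    obtain ⟨r, hr⟩ := Int.eq_ofNat_of_zero_le (h00 ▸ hcol 0 (Nat.zero_le _) : (0 : ℤ) ≤ ω i₀ 0)
    rw [hr] at hcol
    have hrw : r < w + 2 := by have := hnar i₀ hi₀n 0 (Nat.zero_le _); rw [h00, hr] at this; omega
    have hlow : ∀ i ≤ n, (r : ℤ) ≤ ω i 0 + ((w : ℤ) + 1) := fun i hi => by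
      have := hnar i₀ hi₀n i hi; rw [hr] at this; push_cast at this; exact this
    have hbad := H2 w n M r ω hM hω hcol hlow
    -- both parity classes of vertical steps in the column `r` are small
    have hV : ∀ p < 2, ((Finset.range n).filter
        (fun t => t % 2 = p ∧ ω t 0 = (r : ℤ) ∧ ω (t + 1) 0 = (r : ℤ))).card ≤ a := by
      intro p hp
      by_contra hlt
      refine hnP ?_
      rw [hP]; exact ⟨r, Finset.mem_range.2 hrw, p, Finset.mem_range.2 hp, hcol, by omega⟩
    have hK : ((Finset.range n).filter (fun t => ω t 0 = (r : ℤ) ∧ ω (t + 1) 0 = (r : ℤ))).card ≤ a + a := by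
      rw [← Finset.card_filter_add_card_filter_not (p := fun t => t % 2 = 0)]
      refine add_le_add ((Finset.card_le_card fun t ht => ?_).trans (hV 0 (by norm_num)))
        ((Finset.card_le_card fun t ht => ?_).trans (hV 1 (by norm_num))) <;>
      · simp only [Finset.mem_filter] at ht ⊢
        exact ⟨ht.1.1, by omega, ht.1.2⟩
    omega
  exact_mod_cast (hsplit.symm.le.trans (add_le_add h1 h2))

/-! ## Case 1: many vertical steps in one column (T1 and the choice of `j`) -/

/-- **Case 1 bound.** If `c_n ≤ K θⁿ`, `θ² ≤ s/2`, `(1/2)^{⌊n/L⌋} ≤ 2γⁿ`, `L = qs`, then T1 with `m = ⌊n/q⌋ + 1`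
and `j = ⌊m/s⌋` (`C(m, j) ≥ sʲ` by `Zd.pow_le_choose_mul`) bounds the walks with `≥ m` vertical steps of parity
`p` in a column `R` bounding their columns by `c_{n+2j}/sʲ ≤ Kθⁿ2^{-j} ≤ 2K(θγ)ⁿ`. [folklore] -/
theorem case1_bound
    (H1 : ∀ (n m j p : ℕ) (R : ℤ), ((Zd.saws 2 n).filter (fun ω => (∀ i ≤ n, ω i 0 ≤ R) ∧
      m ≤ ((Finset.range n).filter (fun t => t % 2 = p ∧ ω t 0 = R ∧ ω (t + 1) 0 = R)).card)).card
        * m.choose j ≤ Zd.count 2 (n + 2 * j))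
    {q s L : ℕ} (hL : L = q * s) (hs1 : 1 ≤ s) {K θ γ : ℝ} (hK : 0 ≤ K) (hθ : 0 ≤ θ)
    (hc : ∀ n, (Zd.count 2 n : ℝ) ≤ K * θ ^ n) (hs : θ ^ 2 ≤ (s : ℝ) / 2)
    (hγL : ∀ n : ℕ, (1 / 2 : ℝ) ^ (n / L) ≤ 2 * γ ^ n) (n p : ℕ) (R : ℤ) :
    (((Zd.saws 2 n).filter (fun ω => (∀ i ≤ n, ω i 0 ≤ R) ∧ n / q + 1 ≤
        ((Finset.range n).filter (fun t => t % 2 = p ∧ ω t 0 = R ∧ ω (t + 1) 0 = R)).card)).card : ℝ)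
      ≤ 2 * K * (θ * γ) ^ n := by
  classical
  have h1 := H1 n (n / q + 1) ((n / q + 1) / s) p R
  set S := (Zd.saws 2 n).filter (fun ω => (∀ i ≤ n, ω i 0 ≤ R) ∧ n / q + 1 ≤
        ((Finset.range n).filter (fun t => t % 2 = p ∧ ω t 0 = R ∧ ω (t + 1) 0 = R)).card) with hS
  set m := n / q + 1 with hm
  set j := m / s with hj
  have hchoose : s ^ j ≤ m.choose j :=
    (Zd.pow_le_choose_mul s j).trans (Nat.choose_le_choose j (Nat.mul_div_le m s))
  have h2 : (S.card : ℝ) * (s : ℝ) ^ j ≤ K * θ ^ n * (θ ^ 2) ^ j := by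
    have h3 : S.card * s ^ j ≤ Zd.count 2 (n + 2 * j) := (Nat.mul_le_mul_left _ hchoose).trans h1
    calc (S.card : ℝ) * (s : ℝ) ^ j = ((S.card * s ^ j : ℕ) : ℝ) := by push_cast; ring
      _ ≤ Zd.count 2 (n + 2 * j) := by exact_mod_cast h3
      _ ≤ K * θ ^ (n + 2 * j) := hc _
      _ = K * θ ^ n * (θ ^ 2) ^ j := by rw [pow_add, pow_mul]; ring
  have hs0 : (0 : ℝ) < s := by exact_mod_cast hs1
  have h6 : ((s : ℝ) / 2) ^ j = (s : ℝ) ^ j * (1 / 2) ^ j := by rw [← mul_pow]; ring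
  have h4 : (S.card : ℝ) ≤ K * θ ^ n * (1 / 2) ^ j := by
    refine le_of_mul_le_mul_right (h2.trans ?_) (by positivity : (0 : ℝ) < (s : ℝ) ^ j)
    calc K * θ ^ n * (θ ^ 2) ^ j ≤ K * θ ^ n * ((s : ℝ) / 2) ^ j :=
          mul_le_mul_of_nonneg_left (pow_le_pow_left₀ (by positivity) hs j) (by positivity)
      _ = K * θ ^ n * (1 / 2) ^ j * (s : ℝ) ^ j := by rw [h6]; ring
  have hjL : n / L ≤ j := by
    rw [hj, hm, hL, ← Nat.div_div_eq_div_mul]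
    exact Nat.div_le_div_right (Nat.le_succ _)
  calc (S.card : ℝ) ≤ K * θ ^ n * (1 / 2) ^ j := h4
    _ ≤ K * θ ^ n * (2 * γ ^ n) := mul_le_mul_of_nonneg_left
        ((pow_le_pow_of_le_one (by norm_num) (by norm_num) hjL).trans (hγL n)) (by positivity)
    _ = 2 * K * (θ * γ) ^ n := by rw [mul_pow]; ring

/-- **The root `γ = 2^{-1/L}`**: `0 < γ < 1` and `(1/2)^{⌊n/L⌋} ≤ 2 γⁿ`. [folklore] -/
theorem exists_root_half {L : ℕ} (hL : 1 ≤ L) :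
    ∃ γ : ℝ, 0 < γ ∧ γ < 1 ∧ ∀ n : ℕ, (1 / 2 : ℝ) ^ (n / L) ≤ 2 * γ ^ n := by
  obtain ⟨γ, hγ⟩ : ∃ γ : ℝ, γ = (1 / 2 : ℝ) ^ ((L : ℝ)⁻¹) := ⟨_, rfl⟩
  have hγL : γ ^ L = 1 / 2 := hγ ▸ Real.rpow_inv_natCast_pow (by norm_num) (by omega)
  have hγ0 : 0 < γ := hγ ▸ Real.rpow_pos_of_pos (by norm_num) _
  have hγ1 : γ < 1 := hγ ▸ Real.rpow_lt_one (by norm_num) (by norm_num) (by positivity)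
  refine ⟨γ, hγ0, hγ1, fun n => ?_⟩
  calc (1 / 2 : ℝ) ^ (n / L) = 2 * ((γ ^ L) ^ (n / L) * γ ^ L) := by rw [hγL]; ring
    _ ≤ 2 * ((γ ^ L) ^ (n / L) * γ ^ (n % L)) := mul_le_mul_of_nonneg_left (mul_le_mul_of_nonneg_left
        (pow_le_pow_of_le_one hγ0.le hγ1.le (Nat.mod_lt n (by omega)).le) (by positivity)) (by norm_num)
    _ = 2 * γ ^ n := by rw [← pow_mul, ← pow_add, Nat.div_add_mod n L]

/-- **The detour constants**: `s = ⌈8μ²⌉`, `L = qs`, `γ = 2^{-1/L}`, `η = min 1 ((1/γ - 1)/2)`, `θ = (1+η)μ`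
with `c_n ≤ K θⁿ` (`Zd.count_le_mul_pow`), `θ² ≤ 4μ² ≤ s/2` and `θγ < μ`. [folklore] -/
theorem exists_detour_constants {q : ℕ} (hq : 1 ≤ q) :
    ∃ s L : ℕ, 1 ≤ s ∧ L = q * s ∧ ∃ K θ γ : ℝ, 0 ≤ K ∧ 0 ≤ θ ∧ 0 ≤ γ ∧ θ * γ < Zd.connectiveConstant 2 ∧
      (∀ n, (Zd.count 2 n : ℝ) ≤ K * θ ^ n) ∧ θ ^ 2 ≤ (s : ℝ) / 2 ∧
      ∀ n : ℕ, (1 / 2 : ℝ) ^ (n / L) ≤ 2 * γ ^ n := by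
  have hμ2 : 2 ≤ Zd.connectiveConstant 2 := Zd.two_le_connectiveConstant_two_and_le_three.1
  have hs8 : 8 * Zd.connectiveConstant 2 ^ 2 ≤ (⌈8 * Zd.connectiveConstant 2 ^ 2⌉₊ : ℕ) := Nat.le_ceil _
  have hs1 : 1 ≤ ⌈8 * Zd.connectiveConstant 2 ^ 2⌉₊ := Nat.ceil_pos.2 (by positivity)
  obtain ⟨γ, hγ0, hγ1, hγL⟩ := exists_root_half (L := q * ⌈8 * Zd.connectiveConstant 2 ^ 2⌉₊) (Nat.mul_pos hq hs1)
  obtain ⟨η, hη⟩ : ∃ η : ℝ, η = min 1 ((1 / γ - 1) / 2) := ⟨_, rfl⟩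
  have hγ' : 1 < 1 / γ := by rw [lt_div_iff₀ hγ0]; linarith
  have hη0 : 0 < η := by rw [hη]; exact lt_min one_pos (by linarith)
  have hη1 : η ≤ 1 := hη ▸ min_le_left _ _
  have hηγ : (1 + η) * γ < 1 := by
    have h : η ≤ (1 / γ - 1) / 2 := hη ▸ min_le_right _ _
    have h' : (1 + η) * γ ≤ (1 + (1 / γ - 1) / 2) * γ := by gcongr
    have e : (1 + (1 / γ - 1) / 2) * γ = (γ + 1) / 2 := by field_simp; ring
    linarith
  obtain ⟨K, hK1, hK⟩ := Zd.count_le_mul_pow 2 hη0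
  refine ⟨⌈8 * Zd.connectiveConstant 2 ^ 2⌉₊, q * ⌈8 * Zd.connectiveConstant 2 ^ 2⌉₊, hs1, rfl, K,
    (1 + η) * Zd.connectiveConstant 2, γ, by linarith, by positivity, hγ0.le, ?_, hK, ?_, hγL⟩
  · calc (1 + η) * Zd.connectiveConstant 2 * γ = ((1 + η) * γ) * Zd.connectiveConstant 2 := by ring
      _ < 1 * Zd.connectiveConstant 2 := mul_lt_mul_of_pos_right hηγ (by linarith)
      _ = Zd.connectiveConstant 2 := one_mul _
  · calc ((1 + η) * Zd.connectiveConstant 2) ^ 2 ≤ (2 * Zd.connectiveConstant 2) ^ 2 := by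
          apply pow_le_pow_left₀ (by positivity); nlinarith
      _ = (8 * Zd.connectiveConstant 2 ^ 2) / 2 := by ring
      _ ≤ _ := by gcongr

/-! ## Case 2: few bad blocks (the block decomposition and the Chernoff bound) -/

/-- A good block is an `M`-step walk on which `X` fails at step `0`. [folklore] -/
theorem mem_goodWalks_zero {X : ℕ → (ℕ → Site 2) → ℕ → Prop} {M : ℕ} {β : ℕ → Site 2}
    (hβ : β ∈ Zd.goodWalks X M) : β ∈ Zd.saws 2 M ∧ ¬ X M β 0 := by
  classical
  unfold Zd.goodWalks at hβ
  rw [Finset.mem_filter] at hβ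
  exact ⟨hβ.1, hβ.2 0 (Nat.zero_le _)⟩

/-- **Case 2 bound** (as in `Zd.lemma725`): if `λ c_M + #Good ≤ ρ₁^M`, `1 ≤ ρ₁ ≤ ρ₂`, `λ⁻⁴ ≤ (ρ₂/ρ₁)^q`,
the `n`-step walks with `≤ 4⌊n/q⌋ + 4` bad `M`-blocks number `≤ Σ_{|I| ≤ 4⌊n/q⌋+4} c_M^{|I|} #Good^{⌊n/M⌋-|I|}
c_{n mod M} ≤ λ^{-4⌊n/q⌋-4} ρ₁^{M⌊n/M⌋} c_{n mod M} ≤ λ⁻⁴ C ρ₂ⁿ`. [cite: MadrasSlade1993, Lemma 7.2.5] -/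
theorem case2_bound (X : ℕ → (ℕ → Site 2) → ℕ → Prop) {M q : ℕ} (hM : 1 ≤ M)
    {ρ₁ ρ₂ lam : ℝ} (hρ₁ : 1 ≤ ρ₁) (hρ₂ : ρ₁ ≤ ρ₂) (hlam : 0 < lam) (hlam1 : lam ≤ 1)
    (hsum : lam * (Zd.count 2 M : ℝ) + ((Zd.goodWalks X M).card : ℝ) ≤ ρ₁ ^ M)
    (hΛ : (1 / lam) ^ 4 ≤ (ρ₂ / ρ₁) ^ q) (n : ℕ) :
    (((Zd.saws 2 n).filter (fun ω => (Zd.badBlocks X M n ω).card ≤ 4 * (n / q) + 4)).card : ℝ) ≤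
      (1 / lam) ^ 4 * (∑ r ∈ Finset.range M, (Zd.count 2 r : ℝ)) * ρ₂ ^ n := by
  classical
  have hb : (((Zd.saws 2 n).filter fun ω => (Zd.badBlocks X M n ω).card ≤ 4 * (n / q) + 4).card : ℝ) ≤
      (∑ I ∈ (Finset.univ : Finset (Fin (n / M))).powerset.filter (fun I => I.card ≤ 4 * (n / q) + 4),
          (Zd.count 2 M : ℝ) ^ I.card * ((Zd.goodWalks X M).card : ℝ) ^ (n / M - I.card)) *
        (Zd.count 2 (n % M) : ℝ) := by
    have h0' := (Nat.cast_le (α := ℝ)).2 (Zd.card_few_badBlocks_le (d := 0) (X := X) (m := M) n (4 * (n / q) + 4))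
    push_cast at h0'
    rw [Finset.sum_mul]
    exact h0'
  have hc := Zd.sum_filter_card_le_chernoff (n / M) (4 * (n / q) + 4) (Nat.cast_nonneg (Zd.count 2 M))
    (Nat.cast_nonneg (Zd.goodWalks X M).card) hlam hlam1
  have hcr : (Zd.count 2 (n % M) : ℝ) ≤ ∑ r ∈ Finset.range M, (Zd.count 2 r : ℝ) :=
    Finset.single_le_sum (f := fun r => (Zd.count 2 r : ℝ)) (fun _ _ => Nat.cast_nonneg _)
      (Finset.mem_range.2 (Nat.mod_lt n hM))
  have hρ₁0 : 0 < ρ₁ := by linarith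
  have hr : 1 ≤ ρ₂ / ρ₁ := by rw [le_div_iff₀ hρ₁0]; linarith
  have h1 : (1 / lam) ^ (4 * (n / q) + 4) ≤ (ρ₂ / ρ₁) ^ n * (1 / lam) ^ 4 := by
    rw [pow_add, pow_mul]
    refine mul_le_mul_of_nonneg_right ?_ (by positivity)
    calc ((1 / lam) ^ 4) ^ (n / q) ≤ ((ρ₂ / ρ₁) ^ q) ^ (n / q) := pow_le_pow_left₀ (by positivity) hΛ _
      _ = (ρ₂ / ρ₁) ^ (q * (n / q)) := by rw [pow_mul]
      _ ≤ (ρ₂ / ρ₁) ^ n := pow_le_pow_right₀ hr (Nat.mul_div_le n q)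
  have h2 : (lam * (Zd.count 2 M : ℝ) + ((Zd.goodWalks X M).card : ℝ)) ^ (n / M) ≤ ρ₁ ^ n :=
    calc _ ≤ (ρ₁ ^ M) ^ (n / M) := pow_le_pow_left₀ (by positivity) hsum _
      _ = ρ₁ ^ (M * (n / M)) := by rw [pow_mul]
      _ ≤ ρ₁ ^ n := pow_le_pow_right₀ hρ₁ (Nat.mul_div_le n M)
  have h3 : (ρ₂ / ρ₁) ^ n * ρ₁ ^ n = ρ₂ ^ n := by rw [← mul_pow, div_mul_cancel₀ _ hρ₁0.ne']
  have hC0 : 0 ≤ ∑ r ∈ Finset.range M, (Zd.count 2 r : ℝ) := Finset.sum_nonneg fun _ _ => Nat.cast_nonneg _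
  calc _ ≤ _ := hb
    _ ≤ ((1 / lam) ^ (4 * (n / q) + 4) * (lam * (Zd.count 2 M : ℝ) + ((Zd.goodWalks X M).card : ℝ)) ^ (n / M)) *
        ∑ r ∈ Finset.range M, (Zd.count 2 r : ℝ) := mul_le_mul hc hcr (Nat.cast_nonneg _) (by positivity)
    _ ≤ ((ρ₂ / ρ₁) ^ n * (1 / lam) ^ 4 * ρ₁ ^ n) * ∑ r ∈ Finset.range M, (Zd.count 2 r : ℝ) :=
        mul_le_mul_of_nonneg_right (mul_le_mul h1 h2 (by positivity) (by positivity)) hC0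
    _ = (1 / lam) ^ 4 * (∑ r ∈ Finset.range M, (Zd.count 2 r : ℝ)) * ρ₂ ^ n := by rw [← h3]; ring

/-- **The block constants** from the induction hypothesis `G n ≤ C₀ ρ₀ⁿ`, `ρ₀ < μ`: `ρ₁ = (ρ₀+μ)/2`, `M ≥ 1`
with `C₀ρ₀^M ≤ ρ₁^M/2`, `λ = ρ₁^M/(2c_M) ∈ (0, 1]` (so `λ c_M + G M ≤ ρ₁^M` as `μ^M ≤ c_M`), `ρ₂ = (ρ₁+μ)/2`
and `q ≥ 1` with `λ⁻⁴ ≤ (ρ₂/ρ₁)^q`. [folklore] -/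
theorem exists_block_constants {G : ℕ → ℝ} {ρ₀ C₀ : ℝ} (hρ₀ : 0 ≤ ρ₀) (hρ₀μ : ρ₀ < Zd.connectiveConstant 2)
    (hG : ∀ n, G n ≤ C₀ * ρ₀ ^ n) :
    ∃ M : ℕ, 1 ≤ M ∧ ∃ lam ρ₁ ρ₂ : ℝ, 0 < lam ∧ lam ≤ 1 ∧ 1 ≤ ρ₁ ∧ ρ₁ ≤ ρ₂ ∧ ρ₂ < Zd.connectiveConstant 2 ∧
      lam * (Zd.count 2 M : ℝ) + G M ≤ ρ₁ ^ M ∧ ∃ q : ℕ, 1 ≤ q ∧ (1 / lam) ^ 4 ≤ (ρ₂ / ρ₁) ^ q := by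
  have hμ2 : 2 ≤ Zd.connectiveConstant 2 := Zd.two_le_connectiveConstant_two_and_le_three.1
  have hG' : ∀ n, G n ≤ max C₀ 1 * ρ₀ ^ n := fun n =>
    (hG n).trans (mul_le_mul_of_nonneg_right (le_max_left _ _) (pow_nonneg hρ₀ _))
  obtain ⟨ρ₁, hρ₁⟩ : ∃ ρ₁ : ℝ, ρ₁ = (ρ₀ + Zd.connectiveConstant 2) / 2 := ⟨_, rfl⟩
  have hρ₁1 : 1 ≤ ρ₁ := by rw [hρ₁]; linarith
  have hρ₀₁ : ρ₀ < ρ₁ := by rw [hρ₁]; linarith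
  have hρ₁μ : ρ₁ < Zd.connectiveConstant 2 := by rw [hρ₁]; linarith
  have hρ₁0 : 0 < ρ₁ := by linarith
  obtain ⟨M', hM'⟩ := exists_pow_lt_of_lt_one (show 0 < 1 / (2 * max C₀ 1) by positivity)
    (show ρ₀ / ρ₁ < 1 by rwa [div_lt_one hρ₁0])
  have hMb : max C₀ 1 * ρ₀ ^ (M' + 1) ≤ ρ₁ ^ (M' + 1) / 2 := by
    have h1 : (ρ₀ / ρ₁) ^ (M' + 1) ≤ (ρ₀ / ρ₁) ^ M' :=
      pow_le_pow_of_le_one (by positivity) (by rw [div_le_one hρ₁0]; linarith) (by omega)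
    have h2 := h1.trans_lt hM'
    rw [div_pow, div_lt_div_iff₀ (by positivity) (by positivity), one_mul] at h2
    linarith
  have hcM : ρ₁ ^ (M' + 1) ≤ (Zd.count 2 (M' + 1) : ℝ) :=
    (pow_le_pow_left₀ hρ₁0.le hρ₁μ.le _).trans (Zd.pow_connectiveConstant_le_count 2 _)
  have hcM0 : 0 < (Zd.count 2 (M' + 1) : ℝ) := (show 0 < ρ₁ ^ (M' + 1) by positivity).trans_le hcM
  obtain ⟨lam, hlam⟩ : ∃ lam : ℝ, lam = ρ₁ ^ (M' + 1) / (2 * Zd.count 2 (M' + 1)) := ⟨_, rfl⟩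
  have hlam0 : 0 < lam := by rw [hlam]; positivity
  have hlam1 : lam ≤ 1 := by rw [hlam, div_le_one (by positivity)]; linarith
  have hlamc : lam * Zd.count 2 (M' + 1) = ρ₁ ^ (M' + 1) / 2 := by rw [hlam]; field_simp
  obtain ⟨ρ₂, hρ₂⟩ : ∃ ρ₂ : ℝ, ρ₂ = (ρ₁ + Zd.connectiveConstant 2) / 2 := ⟨_, rfl⟩
  have hr : 1 < ρ₂ / ρ₁ := by rw [one_lt_div hρ₁0, hρ₂]; linarith
  obtain ⟨q', hq'⟩ := pow_unbounded_of_one_lt ((1 / lam) ^ 4) hr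
  refine ⟨M' + 1, by omega, lam, ρ₁, ρ₂, hlam0, hlam1, hρ₁1, by rw [hρ₂]; linarith, by rw [hρ₂]; linarith, ?_,
    q' + 1, by omega, hq'.le.trans (pow_le_pow_right₀ hr.le (by omega))⟩
  have := hG' (M' + 1)
  linarith

/-! ## The strip gap -/

/-- **The strip gap `μ(strip_w) < μ(ℤ²)`, from T1 and T2.** For every width `w` there are `ρ < μ` and `C`
with `#{w-narrow n-step self-avoiding walks from 0} ≤ C ρⁿ` for all `n`; by induction on `w` (base: vertical
walks; step: the case split `card_narrow_succ_le` with `case1_bound` and `case2_bound`). [folklore] -/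
theorem strip_gap_of : (∀ (n m j p : ℕ) (R : ℤ), ((Zd.saws 2 n).filter (fun ω => (∀ i ≤ n, ω i 0 ≤ R) ∧ m ≤ ((Finset.range n).filter (fun t => t % 2 = p ∧ ω t 0 = R ∧ ω (t + 1) 0 = R)).card)).card * m.choose j ≤ Zd.count 2 (n + 2 * j)) → (∀ (w n M : ℕ) (R : ℤ) (ω : ℕ → Site 2), 1 ≤ M → ω ∈ Zd.saws 2 n → (∀ i ≤ n, ω i 0 ≤ R) → (∀ i ≤ n, R ≤ ω i 0 + ((w : ℤ) + 1)) → (Zd.badBlocks (fun (M' : ℕ) (β : ℕ → Site 2) (_ : ℕ) => ¬ ∀ i ≤ M', ∀ i' ≤ M', β i 0 ≤ β i' 0 + (w : ℤ)) M n ω).card ≤ 2 * ((Finset.range n).filter (fun t => ω t 0 = R ∧ ω (t + 1) 0 = R)).card + 4) → ∀ w : ℕ, ∃ ρ : ℝ, 0 ≤ ρ ∧ ρ < Zd.connectiveConstant 2 ∧ ∃ C : ℝ, ∀ n : ℕ, (((Zd.saws 2 n).filter (fun ω => ∀ i ≤ n, ∀ i' ≤ n, ω i 0 ≤ ω i' 0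 + (w : ℤ))).card : ℝ) ≤ C * ρ ^ n := by
  intro H1 H2 w
  induction w with
  | zero =>
    refine ⟨1, zero_le_one, by linarith [Zd.two_le_connectiveConstant_two_and_le_three.1], 3, fun n => ?_⟩
    rw [one_pow, mul_one]
    exact_mod_cast card_vertical_le fun ω hω => by
      rw [Finset.mem_filter] at hω
      have h00 : ω 0 0 = 0 := by rw [(Zd.mem_saws.1 hω.1).1]; rfl
      refine ⟨hω.1, fun i hi => le_antisymm ?_ ?_⟩
      · have := hω.2 i hi 0 (Nat.zero_le _); rw [h00] at this; simpa using this
      · have := hω.2 0 (Nat.zero_le _) i hi; rw [h00] at this; simpa using this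
  | succ w ih =>
    obtain ⟨ρ₀, hρ₀, hρ₀μ, C₀, hC₀⟩ := ih
    obtain ⟨M, hM, lam, ρ₁, ρ₂, hlam0, hlam1, hρ₁1, hρ₁₂, hρ₂μ, hsum, q, hq, hΛ⟩ :=
      exists_block_constants hρ₀ hρ₀μ hC₀
    obtain ⟨s, L, hs1, hL, K, θ, γ, hK0, hθ0, hγ0, hθγ, hc, hs, hγL⟩ := exists_detour_constants hq
    -- the good blocks are the `w`-narrow walks: few, by the induction hypothesis
    have hgood : lam * (Zd.count 2 M : ℝ) + ((Zd.goodWalks (fun (M' : ℕ) (β : ℕ → Site 2) (_ : ℕ) =>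
        ¬ ∀ i ≤ M', ∀ i' ≤ M', β i 0 ≤ β i' 0 + (w : ℤ)) M).card : ℝ) ≤ ρ₁ ^ M := by
      refine le_trans (add_le_add le_rfl (Nat.cast_le.2 (Finset.card_le_card fun β hβ => ?_))) hsum
      obtain ⟨hβ, hX⟩ := mem_goodWalks_zero hβ
      exact Finset.mem_filter.2 ⟨hβ, by simpa using hX⟩
    have hρ₂0 : 0 ≤ ρ₂ := by linarith
    refine ⟨max ρ₂ (θ * γ), le_max_of_le_left hρ₂0, max_lt hρ₂μ hθγ,
      (w + 2 : ℕ) * (2 * (2 * K)) + (1 / lam) ^ 4 * ∑ r ∈ Finset.range M, (Zd.count 2 r : ℝ), fun n => ?_⟩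
    have hA : (θ * γ) ^ n ≤ (max ρ₂ (θ * γ)) ^ n := pow_le_pow_left₀ (by positivity) (le_max_right _ _) n
    have hB : ρ₂ ^ n ≤ (max ρ₂ (θ * γ)) ^ n := pow_le_pow_left₀ hρ₂0 (le_max_left _ _) n
    have hC0 : 0 ≤ (1 / lam) ^ 4 * ∑ r ∈ Finset.range M, (Zd.count 2 r : ℝ) :=
      mul_nonneg (by positivity) (Finset.sum_nonneg fun _ _ => Nat.cast_nonneg _)
    calc _ ≤ _ := card_narrow_succ_le H2 w M n (n / q) hM
      _ ≤ (∑ r ∈ Finset.range (w + 2), ∑ p ∈ Finset.range 2, 2 * K * (θ * γ) ^ n) +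
          (1 / lam) ^ 4 * (∑ r ∈ Finset.range M, (Zd.count 2 r : ℝ)) * ρ₂ ^ n :=
          add_le_add (Finset.sum_le_sum fun r _ => Finset.sum_le_sum fun p _ =>
            case1_bound H1 hL hs1 hK0 hθ0 hc hs hγL n p (r : ℤ))
            (case2_bound _ hM hρ₁1 hρ₁₂ hlam0 hlam1 hgood hΛ n)
      _ = (w + 2 : ℕ) * (2 * (2 * K)) * (θ * γ) ^ n +
          (1 / lam) ^ 4 * (∑ r ∈ Finset.range M, (Zd.count 2 r : ℝ)) * ρ₂ ^ n := by
          simp only [Finset.sum_const, Finset.card_range]; push_cast; ring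
      _ ≤ (w + 2 : ℕ) * (2 * (2 * K)) * (max ρ₂ (θ * γ)) ^ n +
          (1 / lam) ^ 4 * (∑ r ∈ Finset.range M, (Zd.count 2 r : ℝ)) * (max ρ₂ (θ * γ)) ^ n :=
          add_le_add (mul_le_mul_of_nonneg_left hA (by positivity)) (mul_le_mul_of_nonneg_left hB hC0)
      _ = _ := by ring

end Summit.CriticalPhenomena.SAWScalingLimit.Theorems.CriticalBubbleBound.Kesten.Strip

end
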